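import Summits.BirchSwinnertonDyer.BirchSwinnertonDyer.Theorems.KolyvaginDepthDoorKNSupplyExactReading
import HarnessLib

/-!
# Route `KolyvaginDepthDoor`, crux `KolyvaginDepthSupplyKN` (stmt-BirchSwinnertonDyer-22820) —
# THE DEPTH-TABLE ROW READING AT ANY RANK, NO TWIST PINNING: «the bit at depth `rank E − 1`»
# `↔` «`Ш(E/ℚ)[p] = 0` ∧ `dim Sel_p(E^{(d_K)}/ℚ) ≤ rank E − 1`»; and «ONE BIT, TWO `Ш`'s»

Helper file of the lead prover of line `levelone` (kdd-p1 g14; `--supports stmt-BirchSwinnertonDyer-22820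
--as helper`); it closes nothing and BSD is not proved by it.

The exact reading (`KolyvaginDepthDoorKNSupplyExactReading`, p681810) states the crux's full `∃`-body
(any square-free `n₁` with the signed clause) at `(E, p, K)`. The depth table's INSTRUMENT ROW asks a
sharper question: is there a non-zero level-one class at depth EXACTLY `ν = rank E(ℚ) − 1` (the
«points first» depth; for rank `2`, a single Kolyvagin prime `ℓ` with `c_1(ℓ) ≠ 0`)? This file reads that
row, for every rank `r ≥ 1` and with NO hypothesis on the twist:

* `kolyvaginClass_depth_ne_zero_iff_shaTrivial_twistSelmer_of_maninPrint` — per `(E, p, K)` on the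
  Kodaira–Néron cell (`p ≥ 5` good ordinary, tower onto, `p ∤ ord_v(Δ_min)` at multiplicative `v`; `K`
  Heegner, `d_K` odd, `≠ −3, −4`, `p ∤ d_K`, `p` split), `1 ≤ r = rank E(ℚ)`:
  «∃ frame, square-free product `n₁` of `r − 1` Kolyvagin primes, datum: `c_1(n₁) ≠ 0`»
  `↔` «`Ш(E/ℚ)[p] = 0` ∧ `#Sel_p(E^{(d_K)}/ℚ) ≤ p^{r−1}`».
  `→`: g8/g9's first-sign door and g6's twist-Selmer reading ((γ) only); `←`: the full structure
  statement (five print facts) — the `E`-side minimal class sits at depth `dim Sel_p(E) − 1 = r − 1`, and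
  the twist side is excluded by `#Sel_p(E^{(d_K)}) ≤ p^{r−1} < p^{r} ≤ p^ν`.
* `kolyvaginClass_prime_ne_zero_iff_shaTrivial_twistSelmer_of_rank_two_of_maninPrint` — the RANK-2 ROW:
  «∃ frame, Kolyvagin prime `ℓ`, datum: `c_1(ℓ) ≠ 0`» `↔` «`Ш(E)[p] = 0` ∧ `#Sel_p(E^{(d_K)}) ≤ p`». This
  SUPERSEDES g13's `kolyvaginClass_one_prime_ne_zero_iff_sha_trivial_of_rank_two_of_maninPrint`, whose
  twist pinning (`rank E^{(d_K)} ≤ 1 ∧ Ш(E^{(d_K)})[p] = 0`) moves from the hypotheses INTO the reading.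
* `twist_rank_eq_and_sha_trivial_of_kolyvaginClass_depth_ne_zero` — **«ONE BIT, TWO `Ш`'s»**, (γ) only:
  if the bit holds at depth `ν = r − 1` and the twist has `ν` INDEPENDENT POINTS (`ν ≤ rank E^{(d_K)}`),
  then `rank E^{(d_K)} = ν`, `E^{(d_K)}(ℚ)[p] = 0` AND `Ш(E^{(d_K)}/ℚ)[p] = 0` — at a rank-2 row whose
  Heegner twist carries one point of infinite order, the single computed class `c_1(ℓ) ≠ 0` certifies
  `Ш[p] = 0` for `E` AND for `E^{(d_K)}` and pins `rank E^{(d_K)} = 1`, with NO Gross–Zagier–Kolyvagin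
  input on the twist.

Per-curve instantiation (the 18 rank-2 depth-table curves, `rank = 2` by the Rank2Observatory kernel
certificates) is bookkeeping on top of these. CONDITIONAL on (γ) and the five print facts where stated;
per `(E, p, K)`; BSD is NOT proved by any of this.

References: [Kolyvagin1991MathAnn] Thm. 2.3; [GrossLMS1991] Prop. 3.7 (2), §5 (5.1); [CastellaSano2026]
Thm. 3; [Zanarella2019] Prop. 2.18, Cor. 2.14; [Howard2004] Lemma 1.6.4; [Mazur1978] Cor. 4.1;
[JetchevLauterStein2009] §3.6 (arXiv:0707.0032); [SilvermanAEC2009] Thm. X.4.2.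
-/

set_option linter.dupNamespace false

noncomputable section

open scoped Classical NumberField

namespace Summit.BirchSwinnertonDyer.BirchSwinnertonDyer.Theorems.KolyvaginDepthDoor

open Literature.NumberTheory.EllipticCurves Literature.NumberTheory.EllipticCurves.ModularForms
  WeierstrassCurve NumberField IsDedekindDomain
open Literature.NumberTheory.DiophantineGeometry (KodairaSymbol)
open Summit.BirchSwinnertonDyer.BirchSwinnertonDyer.Theorems

/-- A square-free natural number with exactly one prime factor is prime. [folklore] -/
private theorem prime_of_squarefree_of_card_primeFactors_eq_one₁₄ {n : ℕ} (hsq : Squarefree n)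
    (h1 : n.primeFactors.card = 1) : n.Prime := by
  obtain ⟨ℓ, hℓ⟩ := Finset.card_eq_one.mp h1
  have hprod := Nat.prod_primeFactors_of_squarefree hsq
  rw [hℓ, Finset.prod_singleton] at hprod
  have hmem : ℓ ∈ n.primeFactors := by rw [hℓ]; exact Finset.mem_singleton_self ℓ
  rw [← hprod]
  exact Nat.prime_of_mem_primeFactors hmem

/-! ## The row at depth `rank E − 1`, any rank -/

/-- **THE DEPTH-TABLE ROW READING AT ANY RANK, NO TWIST PINNING (modulo (γ) and five print facts by
name).** `E/ℚ` non-CM globally minimal with `1 ≤ r = rank E(ℚ)`; `p ≥ 5` good ordinary with `ρ_{E,p^n}`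
onto for all `n` and `p ∤ ord_v(Δ_min)` at multiplicative places; `K` imaginary quadratic Heegner with
`d_K` odd, `≠ −3, −4`, `p ∤ d_K`, `p` split in `K`. THEN «∃ frame, square-free product `n₁` of exactly
`r − 1` Kolyvagin primes, datum: `c_1(n₁) ≠ 0`» `↔` «`Ш(E/ℚ)[p] = 0` ∧ `#Sel_p(E^{(d_K)}/ℚ) ≤ p^{r−1}`».
`→`: the first-sign door of a datum and Kolyvagin's second eigen-bound read on the twist ((γ) only);
`←`: the full mod-`p` structure statement — with `#Sel_p(E) = p^r` the `E`-side minimal class has depth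
`r − 1`, and the twist side would force `p^{ν+1} = #Sel_p(E^{(d_K)}) ≤ p^{r−1}` with `r ≤ ν`. CONDITIONAL
on the named facts; per curve; BSD is not proved by it. [cite: GrossLMS1991, Prop. 3.7 (2), §5 (5.1)]
[cite: CastellaSano2026, Thm. 3] [cite: Zanarella2019, Prop. 2.18, Cor. 2.14] [cite: Howard2004, Lemma 1.6.4]
[cite: Mazur1978, Cor. 4.1] [cite: Kolyvagin1991MathAnn, Thm. 2.3] [cite: SilvermanAEC2009, Thm. X.4.2] -/
theorem kolyvaginClass_depth_ne_zero_iff_shaTrivial_twistSelmer_of_maninPrint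
    (h372 : GrossLMS1991.prop37_2_frobeniusCongruence)
    (h3 : Literature.NumberTheory.EllipticCurves.CastellaSano2026_kolyvaginClass_selmerDivisibility_eq_padicValNat_tamagawaProduct)
    (hZ : Literature.NumberTheory.EllipticCurves.Zanarella2019_kolyvaginClass_one_ne_zero_of_not_selmerDivisible)
    (hHZ : Literature.NumberTheory.EllipticCurves.HowardZanarella_exists_minimal_kolyvaginClass_one_selmerCard_of_ne_zero)
    (hnf : exists_isNewformOf) (hMaz : mazur_not_dvd_maninConstant_of_odd)
    (W : WeierstrassCurve ℚ) [W.IsElliptic] [W.IsGloballyMinimal] (hcm : ¬ W.HasCM)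
    (hr : 1 ≤ W.mordellWeilRank)
    (p : ℕ) [hp : Fact p.Prime] (h5 : 5 ≤ p) (hgood : W.HasGoodReductionAtPrime p)
    (hord : ¬ (p : ℤ) ∣ W.frobeniusTrace p)
    (htower : ∀ n : ℕ, W.HasSurjectiveModNGaloisRep (p ^ n : ℕ))
    (hKN : ∀ v : HeightOneSpectrum (𝓞 ℚ), W.HasMultiplicativeReductionAt v →
      ¬ p ∣ W.ordMinimalDiscriminant v)
    (K : Type) [Field K] [NumberField K] (hK : IsImaginaryQuadratic K)
    (hodd : Odd (NumberField.discr K)) (hD3 : NumberField.discr K ≠ -3) (hD4 : NumberField.discr K ≠ -4)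
    (hpD : ¬ ((p : ℤ) ∣ NumberField.discr K)) (hspl : SatisfiesHeegnerHypothesis p K)
    [NeZero (W.conductorNorm ℤ)] (hH : SatisfiesHeegnerHypothesis (W.conductorNorm ℤ) K) :
    (∃ (Dt : ModularParametrizationData W (W.conductorNorm ℤ)) (β : ℤ) (ι : K →+* ℂ) (n₁ : ℕ)
      (d : KolyvaginHeegnerData Dt β ι n₁), Squarefree n₁ ∧
        (∀ q ∈ n₁.primeFactors, Zhang2014.IsKolyvaginPrime (W.conductorNorm ℤ) W K p q) ∧
        n₁.primeFactors.card + 1 = W.mordellWeilRank ∧ d.kolyvaginClass hp.out 1 ≠ 0) ↔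
    ((W.sha ⊓ AddSubgroup.torsionBy W.galH1 (p : ℤ) : AddSubgroup W.galH1) = ⊥ ∧
      Nat.card ((W.quadraticTwist (NumberField.discr K : ℚ)).selmerGroup p) ≤
        p ^ (W.mordellWeilRank - 1)) := by
  have hpP : p.Prime := hp.out
  have hp2 : p ≠ 2 := by omega
  have h1p : 1 < p := hpP.one_lt
  have h2p : 2 ≤ p := hpP.two_le
  have hsur : W.HasSurjectiveModNGaloisRep p := by simpa only [pow_one] using htower 1
  constructor
  · -- the first-sign door of a datum + the twist-Selmer reading, (γ) only
    rintro ⟨Dt, β, ι, n₁, d, hn₁, hk₁, hν, hne⟩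
    have hadd : ∀ v : HeightOneSpectrum (𝓞 ℚ), W.HasAdditiveReductionAt v → p ≠ 3 ∨
        (W.kodairaSymbolAt v ≠ KodairaSymbol.IV ∧ W.kodairaSymbolAt v ≠ KodairaSymbol.IVstar) :=
      fun _ _ ↦ Or.inl (by omega)
    obtain ⟨c, hc, hcc⟩ := exists_conj_of_isImaginaryQuadratic K hK
    have hrank : n₁.primeFactors.card + 1 ≤ W.mordellWeilRank := hν.le
    obtain ⟨-, -, -, -, hbot, -⟩ :=
      shaCorank_eq_zero_of_kolyvaginClass_ne_zero_of_rank_le_of_datum_kodairaNeron h372 hcm hK hD3 hD4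
        hH p hp2 htower c hc hcc hKN hadd hn₁ hk₁ d hne hrank
    obtain ⟨-, hSelT, -⟩ :=
      natCard_selmerGroup_twist_le_of_kolyvaginClass_ne_zero_of_datum_kodairaNeron h372 hcm hK hD3 hD4
        hH p hp2 htower c hc hcc hKN hadd hn₁ hk₁ d hne hrank
    refine ⟨by simpa only [pow_one] using hbot, ?_⟩
    have hνr : W.mordellWeilRank - 1 = n₁.primeFactors.card := by omega
    rw [hνr]
    rw [pow_one] at hSelT
    exact hSelT
  · -- the full structure statement (five print facts); the twist side is excluded
    rintro ⟨hshaW, hSelT⟩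
    obtain ⟨Dt, β, ι, n, d, hsupp, hne, hdich⟩ :=
      exists_kolyvaginClass_one_selmerCard_dichotomy_of_maninPrint h3 hZ hHZ hnf hMaz W p h5 hgood hord
        htower hKN K hK hH hodd hD3 hD4 hpD hspl
    have hirr : W.HasIrreducibleModPGaloisRep p :=
      hasIrreducibleModPGaloisRep_of_hasSurjectiveModNGaloisRep W p hsur
    have hSelW : Nat.card (W.selmerGroup p) = p ^ W.mordellWeilRank :=
      natCard_selmerGroup_eq_pow_rank_of_sha_inf_torsionBy_eq_bot W p hirr hshaW
    rcases hdich with ⟨hW1, -⟩ | ⟨hT1, hWle⟩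
    · -- `E`-side: depth `ν = rank E − 1`
      rw [hSelW] at hW1
      have := Nat.pow_right_injective h2p hW1
      exact ⟨Dt, β, ι, n, d, hsupp.1, hsupp.2, by omega, hne⟩
    · -- twist side: `p^{ν+1} = #Sel_p(E^{(d_K)}) ≤ p^{r−1}` and `p^r ≤ p^ν` — impossible
      exfalso
      rw [hSelW] at hWle
      have hrle := (Nat.pow_le_pow_iff_right h1p).mp hWle
      rw [hT1] at hSelT
      have hle := (Nat.pow_le_pow_iff_right h1p).mp hSelT
      omega

/-! ## The rank-2 row -/

/-- **THE RANK-2 ROW, NO TWIST PINNING (modulo (γ) and five print facts by name).** `E/ℚ` non-CM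
globally minimal of Mordell–Weil rank `2`; `p`, `K` as in
`kolyvaginClass_depth_ne_zero_iff_shaTrivial_twistSelmer_of_maninPrint`. THEN «∃ frame, Kolyvagin prime
`ℓ`, datum of conductor `ℓ`: `c_1(ℓ) ≠ 0`» `↔` «`Ш(E/ℚ)[p] = 0` ∧ `#Sel_p(E^{(d_K)}/ℚ) ≤ p`». g13's
`kolyvaginClass_one_prime_ne_zero_iff_sha_trivial_of_rank_two_of_maninPrint` assumed the twist PINNED
(`rank E^{(d_K)} ≤ 1`, `Ш(E^{(d_K)})[p] = 0`); here the twist enters only through the conclusion-side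
conjunct `dim Sel_p(E^{(d_K)}) ≤ 1`. The depth-table bit at a rank-2 row of the Kodaira–Néron cell is
therefore EXACTLY «`Ш(E)[p] = 0` and the Heegner twist's `p`-Selmer group has order `≤ p`». CONDITIONAL
on the named facts; per curve; BSD is not proved by it. [cite: GrossLMS1991, Prop. 3.7 (2)]
[cite: CastellaSano2026, Thm. 3] [cite: Zanarella2019, Prop. 2.18] [cite: Howard2004, Lemma 1.6.4]
[cite: Mazur1978, Cor. 4.1] [cite: JetchevLauterStein2009, §3.6 (arXiv:0707.0032)] -/
theorem kolyvaginClass_prime_ne_zero_iff_shaTrivial_twistSelmer_of_rank_two_of_maninPrint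
    (h372 : GrossLMS1991.prop37_2_frobeniusCongruence)
    (h3 : Literature.NumberTheory.EllipticCurves.CastellaSano2026_kolyvaginClass_selmerDivisibility_eq_padicValNat_tamagawaProduct)
    (hZ : Literature.NumberTheory.EllipticCurves.Zanarella2019_kolyvaginClass_one_ne_zero_of_not_selmerDivisible)
    (hHZ : Literature.NumberTheory.EllipticCurves.HowardZanarella_exists_minimal_kolyvaginClass_one_selmerCard_of_ne_zero)
    (hnf : exists_isNewformOf) (hMaz : mazur_not_dvd_maninConstant_of_odd)
    (W : WeierstrassCurve ℚ) [W.IsElliptic] [W.IsGloballyMinimal] (hcm : ¬ W.HasCM)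
    (hr : W.mordellWeilRank = 2)
    (p : ℕ) [hp : Fact p.Prime] (h5 : 5 ≤ p) (hgood : W.HasGoodReductionAtPrime p)
    (hord : ¬ (p : ℤ) ∣ W.frobeniusTrace p)
    (htower : ∀ n : ℕ, W.HasSurjectiveModNGaloisRep (p ^ n : ℕ))
    (hKN : ∀ v : HeightOneSpectrum (𝓞 ℚ), W.HasMultiplicativeReductionAt v →
      ¬ p ∣ W.ordMinimalDiscriminant v)
    (K : Type) [Field K] [NumberField K] (hK : IsImaginaryQuadratic K)
    (hodd : Odd (NumberField.discr K)) (hD3 : NumberField.discr K ≠ -3) (hD4 : NumberField.discr K ≠ -4)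
    (hpD : ¬ ((p : ℤ) ∣ NumberField.discr K)) (hspl : SatisfiesHeegnerHypothesis p K)
    [NeZero (W.conductorNorm ℤ)] (hH : SatisfiesHeegnerHypothesis (W.conductorNorm ℤ) K) :
    (∃ (Dt : ModularParametrizationData W (W.conductorNorm ℤ)) (β : ℤ) (ι : K →+* ℂ) (ℓ : ℕ)
      (d : KolyvaginHeegnerData Dt β ι ℓ),
      ℓ.Prime ∧ Zhang2014.IsKolyvaginPrime (W.conductorNorm ℤ) W K p ℓ ∧
        d.kolyvaginClass hp.out 1 ≠ 0) ↔
    ((W.sha ⊓ AddSubgroup.torsionBy W.galH1 (p : ℤ) : AddSubgroup W.galH1) = ⊥ ∧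
      Nat.card ((W.quadraticTwist (NumberField.discr K : ℚ)).selmerGroup p) ≤ p) := by
  have key := kolyvaginClass_depth_ne_zero_iff_shaTrivial_twistSelmer_of_maninPrint h372 h3 hZ hHZ hnf
    hMaz W hcm (by omega) p h5 hgood hord htower hKN K hK hodd hD3 hD4 hpD hspl hH
  have hr1 : W.mordellWeilRank - 1 = 1 := by omega
  constructor
  · rintro ⟨Dt, β, ι, ℓ, d, hℓ, hkol, hne⟩
    have hk : ∀ q ∈ ℓ.primeFactors, Zhang2014.IsKolyvaginPrime (W.conductorNorm ℤ) W K p q := by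
      intro q hq
      rw [hℓ.primeFactors, Finset.mem_singleton] at hq
      exact hq ▸ hkol
    have hν : ℓ.primeFactors.card + 1 = W.mordellWeilRank := by
      rw [hℓ.primeFactors, Finset.card_singleton, hr]
    obtain ⟨hsha, hSel⟩ := key.mp ⟨Dt, β, ι, ℓ, d, hℓ.squarefree, hk, hν, hne⟩
    rw [hr1, pow_one] at hSel
    exact ⟨hsha, hSel⟩
  · rintro ⟨hsha, hSel⟩
    have hSel' : Nat.card ((W.quadraticTwist (NumberField.discr K : ℚ)).selmerGroup p) ≤
        p ^ (W.mordellWeilRank - 1) := by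
      rw [hr1, pow_one]; exact hSel
    obtain ⟨Dt, β, ι, n₁, d, hsq, hkol, hν, hne⟩ := key.mpr ⟨hsha, hSel'⟩
    have h1 : n₁.primeFactors.card = 1 := by omega
    have hn : n₁.Prime := prime_of_squarefree_of_card_primeFactors_eq_one₁₄ hsq h1
    have hmem : n₁ ∈ n₁.primeFactors := by
      rw [hn.primeFactors]; exact Finset.mem_singleton_self n₁
    exact ⟨Dt, β, ι, n₁, d, hn, hkol n₁ hmem, hne⟩

/-! ## «One bit, two `Ш`'s» -/

/-- **«ONE BIT, TWO `Ш`'s» ((γ) only).** `E/ℚ` non-CM globally minimal, `K` imaginary quadratic Heegner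
(`d_K ≠ −3, −4`), `p ≥ 5` with `ρ_{E,p^n}` onto for all `n` and `p ∤ ord_v(Δ_min)` at multiplicative
`v`. IF some frame, some square-free product `n₁` of `ν` Kolyvagin primes and some datum have
`c_1(n₁) ≠ 0` with `ν + 1 ≤ rank E(ℚ)` (the bit at the «points first» depth), AND the twist carries `ν`
independent points (`ν ≤ rank E^{(d_K)}(ℚ)`), THEN `rank E(ℚ) = ν + 1`, `Ш(E/ℚ)[p] = 0`,
`rank E^{(d_K)}(ℚ) = ν`, `E^{(d_K)}(ℚ)[p] = 0` and `Ш(E^{(d_K)}/ℚ)[p] = 0`: Kolyvagin's second eigen-bound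
`#Sel_p(E^{(d_K)}) ≤ p^ν` read against the `ν` known points on the twist (AEC X.4.2). At a rank-2 row
whose Heegner twist has ONE point of infinite order, the single class `c_1(ℓ) ≠ 0` certifies
`Ш[p] = 0` for BOTH `E` and `E^{(d_K)}` and pins `rank E^{(d_K)} = 1` — no Gross–Zagier–Kolyvagin input
on the twist. CONDITIONAL on (γ) only; per curve; BSD is not proved by it.
[cite: Kolyvagin1991MathAnn, Thm. 2.3] [cite: GrossLMS1991, Prop. 3.7 (2), §5 (5.1)]
[cite: SilvermanAEC2009, Thm. X.4.2] -/
theorem twist_rank_eq_and_sha_trivial_of_kolyvaginClass_depth_ne_zero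
    (h372 : GrossLMS1991.prop37_2_frobeniusCongruence)
    (W : WeierstrassCurve ℚ) [W.IsElliptic] [W.IsGloballyMinimal] (hcm : ¬ W.HasCM)
    (p : ℕ) [hp : Fact p.Prime] (h5 : 5 ≤ p)
    (htower : ∀ n : ℕ, W.HasSurjectiveModNGaloisRep (p ^ n : ℕ))
    (hKN : ∀ v : HeightOneSpectrum (𝓞 ℚ), W.HasMultiplicativeReductionAt v →
      ¬ p ∣ W.ordMinimalDiscriminant v)
    (K : Type) [Field K] [NumberField K] (hK : IsImaginaryQuadratic K)
    (hD3 : NumberField.discr K ≠ -3) (hD4 : NumberField.discr K ≠ -4)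
    [NeZero (W.conductorNorm ℤ)] (hH : SatisfiesHeegnerHypothesis (W.conductorNorm ℤ) K)
    {Dt : ModularParametrizationData W (W.conductorNorm ℤ)} {β : ℤ} {ι : K →+* ℂ} {n₁ : ℕ}
    (hn₁ : Squarefree n₁)
    (hk₁ : ∀ q ∈ n₁.primeFactors, Zhang2014.IsKolyvaginPrime (W.conductorNorm ℤ) W K p q)
    (d : KolyvaginHeegnerData Dt β ι n₁) (hne : d.kolyvaginClass hp.out 1 ≠ 0)
    (hrank : n₁.primeFactors.card + 1 ≤ W.mordellWeilRank)
    (hrank' : n₁.primeFactors.card ≤ (W.quadraticTwist (NumberField.discr K : ℚ)).mordellWeilRank) :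
    W.mordellWeilRank = n₁.primeFactors.card + 1 ∧
      (W.sha ⊓ AddSubgroup.torsionBy W.galH1 (p : ℤ) : AddSubgroup W.galH1) = ⊥ ∧
      (W.quadraticTwist (NumberField.discr K : ℚ)).mordellWeilRank = n₁.primeFactors.card ∧
      Nat.card ↥(AddSubgroup.torsionBy (W.quadraticTwist (NumberField.discr K : ℚ)).toAffine.Point
        (p : ℤ)) = 1 ∧
      (((W.quadraticTwist (NumberField.discr K : ℚ)).sha ⊓
          AddSubgroup.torsionBy (W.quadraticTwist (NumberField.discr K : ℚ)).galH1 (p : ℤ) :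
          AddSubgroup (W.quadraticTwist (NumberField.discr K : ℚ)).galH1) = ⊥) := by
  have hpP : p.Prime := hp.out
  have hp2 : p ≠ 2 := by omega
  have hadd : ∀ v : HeightOneSpectrum (𝓞 ℚ), W.HasAdditiveReductionAt v → p ≠ 3 ∨
      (W.kodairaSymbolAt v ≠ KodairaSymbol.IV ∧ W.kodairaSymbolAt v ≠ KodairaSymbol.IVstar) :=
    fun _ _ ↦ Or.inl (by omega)
  obtain ⟨c, hc, hcc⟩ := exists_conj_of_isImaginaryQuadratic K hK
  obtain ⟨-, hr, -, -, hbot, -⟩ :=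
    shaCorank_eq_zero_of_kolyvaginClass_ne_zero_of_rank_le_of_datum_kodairaNeron h372 hcm hK hD3 hD4 hH
      p hp2 htower c hc hcc hKN hadd hn₁ hk₁ d hne hrank
  obtain ⟨-, hSelT, -⟩ :=
    natCard_selmerGroup_twist_le_of_kolyvaginClass_ne_zero_of_datum_kodairaNeron h372 hcm hK hD3 hD4 hH
      p hp2 htower c hc hcc hKN hadd hn₁ hk₁ d hne hrank
  have hdK : (NumberField.discr K : ℚ) ≠ 0 := by exact_mod_cast NumberField.discr_ne_zero K
  haveI := W.isElliptic_quadraticTwist hdK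
  rw [pow_one] at hSelT
  obtain ⟨hr', ht', hbot', -⟩ :=
    rank_and_sha_of_natCard_selmerGroup_le (W.quadraticTwist (NumberField.discr K : ℚ)) hpP.one_lt
      n₁.primeFactors.card hSelT hrank'
  exact ⟨hr, by simpa only [pow_one] using hbot, hr', by convert ht', hbot'⟩

end Summit.BirchSwinnertonDyer.BirchSwinnertonDyer.Theorems.KolyvaginDepthDoor

end
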